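import Literature.GroupTheory.CombinatorialGroupTheory.SchreierRibbonGraphFaces
import Literature.GroupTheory.CombinatorialGroupTheory.PresentedGroupKillGenerators
import Mathlib.GroupTheory.FreeGroup.Reduce
import HarnessLib

/-!
# The Schreier ribbon graph of a subgroup, II: preliminaries for the contracted system

Topic `Literature/GroupTheory/CombinatorialGroupTheory`; theorems only.  Continues
`SchreierRibbonGraphFaces.lean` (the orbit faces of the covering of a one-vertex face system
`S` belonging to a subgroup `K ≤ F(X)` of finite index).  Four bookkeeping facts used when the
spanning tree of the covering is contracted and the faces are read in Schreier's free basis of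
`K` (Hoare–Karrass–Solitar 1971, proof of Thm. 1; ZVC LNM 835, 3.1.2, 3.1.6, Thm. 4.14.1):

* `formPerm_ne_bar_of_transitive`, `isReduced_append_self_of_transitive` — in a face system with
  ONE vertex no letter is followed, cyclically in its face, by its partner: every face `L` is
  CYCLICALLY REDUCED (`L ++ L` is a reduced word); hence `isReduced_powWord`,
  `mk_powWord_ne_one`: the powers `L^m`, `m ≥ 1`, of a nonempty face are reduced and `≠ 1` in
  `F(X)` (so a contracted orbit face, whose value in `K` is a conjugate of `(mk L)^m`, is never
  empty);
* `inclLetter_sysPerm`, `sameCycle_sysPerm_of_inclLetter` — the vertex permutation of a SYSTEM of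
  faces over the surviving symbols `{i ∉ T}` is carried to that of the forgetful system by the
  inclusion of letters (`inclLetter`, `PresentedGroupKillGenerators.lean`), so one-vertex-ness
  transfers back along the inclusion;
* `lift_kill_mk_eq_mk_restrictWord_filter` — killing the symbols of `T` in the word of a face is
  the word of the face with its `T`-letters deleted, restricted to the surviving symbols;
* `exists_mem_mul_mul_iff_of_inv_mul_mem` — two representatives of one coset of `K` define the
  same double-coset condition `rep ∈ K · δ · Z`.

## References

* H. Zieschang, E. Vogt, H.-D. Coldewey, *Surfaces and Planar Discontinuous Groups*, LNM 835,
  Springer 1980, 3.1.2, 3.1.6, 4.14.1. [ZieschangVogtColdewey1980]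
* A. H. M. Hoare, A. Karrass, D. Solitar, *Subgroups of finite index of Fuchsian groups*,
  Math. Z. 120 (1971) 289–298, Thm. 1. [HoareKarrassSolitar1971]
-/

namespace Literature.GroupTheory.CombinatorialGroupTheory

open List Equiv Equiv.Perm

variable {ι : Type*} [DecidableEq ι]

/-! ### One-vertex systems have cyclically reduced faces -/

/-- **In a one-vertex face system no letter is followed by its partner**: if the letters of the
faces `S` are pairwise distinct and the vertex permutation `sysPerm S` is transitive, then for a
letter `a` of a face `L ∈ S` the cyclic successor of `a` in `L` is not `ā` (otherwise `ā` would be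
a fixed point of `sysPerm S`). [cite: ZieschangVogtColdewey1980, 3.1.2] -/
theorem formPerm_ne_bar_of_transitive {S : List (List (ι × Bool))} (hd : S.flatten.Nodup)
    (htrans : ∀ x y : ι × Bool, (sysPerm S).SameCycle x y) {L : List (ι × Bool)} (hL : L ∈ S)
    {a : ι × Bool} (ha : a ∈ L) : L.formPerm a ≠ bar a := by
  intro h
  have hfix : sysPerm S (bar a) = bar a := by
    rw [sysPerm_apply_of_bar_mem hd hL (by rw [bar_bar]; exact ha), bar_bar, h]
  obtain ⟨n, hn⟩ := htrans (bar a) a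
  rw [Equiv.Perm.zpow_apply_eq_self_of_apply_eq_self hfix n] at hn
  exact bar_ne_self a hn

omit [DecidableEq ι] in
/-- Two letters over the same symbol with different signs are partners. [folklore] -/
private theorem eq_bar_of_fst_eq {a b : ι × Bool} (h1 : a.1 = b.1) (h2 : a.2 ≠ b.2) : b = bar a := by
  obtain ⟨i, s⟩ := a
  obtain ⟨j, t⟩ := b
  simp only at h1 h2
  subst h1
  cases s <;> cases t
  · exact absurd rfl h2
  · rfl
  · rfl
  · exact absurd rfl h2

/-- **The faces of a one-vertex system are cyclically reduced**: for `L ∈ S` (letters of `S`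
pairwise distinct, `sysPerm S` transitive) the word `L ++ L` is reduced — no two cyclically
consecutive letters of `L` cancel. [cite: ZieschangVogtColdewey1980, 3.1.2] -/
theorem isReduced_append_self_of_transitive {S : List (List (ι × Bool))} (hd : S.flatten.Nodup)
    (htrans : ∀ x y : ι × Bool, (sysPerm S).SameCycle x y) {L : List (ι × Bool)} (hL : L ∈ S) :
    FreeGroup.IsReduced (L ++ L) := by
  have hdL : L.Nodup := (nodup_flatten.1 hd).1 L hL
  have key : ∀ a b : ι × Bool, a ∈ L → L.formPerm a = b → (a.1 = b.1 → a.2 = b.2) := by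
    intro a b ha hab h1
    by_contra h2
    exact formPerm_ne_bar_of_transitive hd htrans hL ha (hab.trans (eq_bar_of_fst_eq h1 h2))
  have hred : FreeGroup.IsReduced L := by
    rw [FreeGroup.IsReduced, isChain_iff_forall_rel_of_append_cons_cons]
    intro a b l₁ l₂ e
    have ha : a ∈ L := by rw [e]; simp
    exact key a b ha (by rw [e]; exact formPerm_apply_mid l₁ l₂ a b (e ▸ hdL))
  rw [FreeGroup.IsReduced] at hred ⊢
  refine isChain_append.2 ⟨hred, hred, fun x hx y hy => ?_⟩
  have hL0 : L ≠ [] := by rintro rfl; simp at hx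
  rw [getLast?_eq_some_getLast hL0, Option.mem_def, Option.some.injEq] at hx
  rw [head?_eq_some_head hL0, Option.mem_def, Option.some.injEq] at hy
  subst hx hy
  exact key _ _ (getLast_mem hL0) (formPerm_apply_getLast' L hL0)

omit [DecidableEq ι] in
/-- **Powers of a cyclically reduced word are reduced.** [cite: ZieschangVogtColdewey1980, 4.14.1] -/
theorem isReduced_powWord {L : List (ι × Bool)} (h : FreeGroup.IsReduced (L ++ L)) :
    ∀ m : ℕ, FreeGroup.IsReduced (List.replicate m L).flatten
  | 0 => FreeGroup.IsReduced.nil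
  | 1 => by
    have : (List.replicate 1 L).flatten = L := by simp
    rw [this]
    exact h.infix ⟨[], L, by simp⟩
  | m + 2 => by
    rcases eq_or_ne L [] with rfl | hL
    · have : (List.replicate (m + 2) ([] : List (ι × Bool))).flatten = [] := by simp
      rw [this]
      exact FreeGroup.IsReduced.nil
    · have ih := isReduced_powWord h (m + 1)
      rw [powWord_succ] at ih
      rw [powWord_succ, powWord_succ, ← List.append_assoc]
      exact h.append_overlap ih hL

/-- **A nonempty cyclically reduced word has nontrivial powers**: `mk (L^m) ≠ 1` for `m ≥ 1`.
[cite: ZieschangVogtColdewey1980, 4.14.1] -/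
theorem mk_powWord_ne_one {L : List (ι × Bool)} (h : FreeGroup.IsReduced (L ++ L)) (hL : L ≠ [])
    {m : ℕ} (hm : 0 < m) : FreeGroup.mk (List.replicate m L).flatten ≠ 1 := by
  intro h1
  have h2 := congrArg FreeGroup.toWord h1
  rw [FreeGroup.toWord_mk, (isReduced_powWord h m).reduce_eq, FreeGroup.toWord_one] at h2
  have h3 := congrArg List.length h2
  rw [length_powWord, List.length_nil] at h3
  have hl : 0 < L.length := length_pos_of_ne_nil hL
  exact Nat.mul_ne_zero hm.ne' hl.ne' h3

/-- In a one-vertex face system the powers of the (nonempty) faces are nontrivial in the free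
group. [cite: ZieschangVogtColdewey1980, 4.14.1] -/
theorem mk_powWord_ne_one_of_transitive {S : List (List (ι × Bool))} (hd : S.flatten.Nodup)
    (htrans : ∀ x y : ι × Bool, (sysPerm S).SameCycle x y) {L : List (ι × Bool)} (hL : L ∈ S)
    (hL0 : L ≠ []) {m : ℕ} (hm : 0 < m) : FreeGroup.mk (List.replicate m L).flatten ≠ 1 :=
  mk_powWord_ne_one (isReduced_append_self_of_transitive hd htrans hL) hL0 hm

/-! ### Transport of the vertex permutation of a system along the inclusion of letters -/

omit [DecidableEq ι] in
/-- The letters of the forgetful system are the images of the letters. [cite: ZieschangVogtColdewey1980, 3.1.2] -/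
theorem flatten_map_map_inclLetter (T : Set ι) (Fs' : List (List ({i // i ∉ T} × Bool))) :
    (Fs'.map (List.map (inclLetter T))).flatten = Fs'.flatten.map (inclLetter T) := by
  rw [map_flatten]

/-- **The inclusion of letters intertwines the vertex permutations** of a system over the surviving
symbols `{i ∉ T}` and of its image over all symbols. [cite: ZieschangVogtColdewey1980, 3.1.2] -/
theorem inclLetter_sysPerm (T : Set ι) {Fs' : List (List ({i // i ∉ T} × Bool))} (hd : Fs'.flatten.Nodup)
    (x : {i // i ∉ T} × Bool) :
    inclLetter T (sysPerm Fs' x) = sysPerm (Fs'.map (List.map (inclLetter T))) (inclLetter T x) := by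
  have hd₁ : (Fs'.map (List.map (inclLetter T))).flatten.Nodup := by
    rw [flatten_map_map_inclLetter]; exact hd.map (inclLetter_injective T)
  by_cases hx : bar x ∈ Fs'.flatten
  · obtain ⟨F, hF, hxF⟩ := mem_flatten.1 hx
    have hF₁ : F.map (inclLetter T) ∈ Fs'.map (List.map (inclLetter T)) := mem_map.2 ⟨F, hF, rfl⟩
    have hxF₁ : bar (inclLetter T x) ∈ F.map (inclLetter T) := by
      rw [← inclLetter_bar]; exact mem_map.2 ⟨_, hxF, rfl⟩
    rw [sysPerm_apply_of_bar_mem hd hF hxF, sysPerm_apply_of_bar_mem hd₁ hF₁ hxF₁, ← inclLetter_bar,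
      formPerm_map_of_injective (inclLetter_injective T) ((nodup_flatten.1 hd).1 F hF)]
  · have hx₁ : bar (inclLetter T x) ∉ (Fs'.map (List.map (inclLetter T))).flatten := by
      rw [flatten_map_map_inclLetter, ← inclLetter_bar]
      intro h
      obtain ⟨y, hy, he⟩ := mem_map.1 h
      exact hx (inclLetter_injective T he ▸ hy)
    rw [sysPerm_apply, sysPerm_apply, prod_formPerm_apply_of_not_mem hx, prod_formPerm_apply_of_not_mem hx₁,
      inclLetter_bar]

/-- Iterated form. [cite: ZieschangVogtColdewey1980, 3.1.2] -/
theorem inclLetter_sysPerm_pow (T : Set ι) {Fs' : List (List ({i // i ∉ T} × Bool))} (hd : Fs'.flatten.Nodup)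
    (n : ℕ) (x : {i // i ∉ T} × Bool) :
    inclLetter T ((sysPerm Fs' ^ n) x) = (sysPerm (Fs'.map (List.map (inclLetter T))) ^ n) (inclLetter T x) := by
  induction n with
  | zero => rfl
  | succ n ih => rw [pow_succ', Perm.mul_apply, inclLetter_sysPerm T hd, ih, pow_succ', Perm.mul_apply]

/-- **One-vertex-ness transfers back along the inclusion of letters**: if the images of `x`, `z` lie
in one cycle of the vertex permutation of the forgetful system, then `x`, `z` lie in one cycle of
the vertex permutation of the system over the surviving symbols. [cite: ZieschangVogtColdewey1980, 3.1.2] -/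
theorem sameCycle_sysPerm_of_inclLetter [Finite ι] (T : Set ι) {Fs' : List (List ({i // i ∉ T} × Bool))}
    (hd : Fs'.flatten.Nodup) {x z : {i // i ∉ T} × Bool}
    (h : (sysPerm (Fs'.map (List.map (inclLetter T)))).SameCycle (inclLetter T x) (inclLetter T z)) :
    (sysPerm Fs').SameCycle x z := by
  obtain ⟨n, hn⟩ := h.exists_nat_pow_eq
  rw [← inclLetter_sysPerm_pow T hd] at hn
  exact ⟨n, by rw [zpow_natCast]; exact inclLetter_injective T hn⟩

/-! ### Killing the tree symbols in a face word -/

omit [DecidableEq ι] in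
/-- The letters surviving the filter "symbol not in `T`" have symbols outside `T`.
[cite: ZieschangVogtColdewey1980, 2.2.5] -/
theorem fst_not_mem_of_mem_filter (T : Set ι) [DecidablePred (· ∈ T)] (W : List (ι × Bool))
    (x : ι × Bool) (hx : x ∈ W.filter fun y => !decide (y.1 ∈ T)) : x.1 ∉ T := by
  have := (mem_filter.1 hx).2
  simpa using this

omit [DecidableEq ι] in
/-- **Killing the symbols of `T` in a word is the word with its `T`-letters deleted, restricted to
the surviving symbols.** [cite: ZieschangVogtColdewey1980, 2.2.5] -/
theorem lift_kill_mk_eq_mk_restrictWord_filter (T : Set ι) [DecidablePred (· ∈ T)] (W : List (ι × Bool)) :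
    FreeGroup.lift (fun i => if h : i ∈ T then (1 : FreeGroup {i // i ∉ T}) else FreeGroup.of ⟨i, h⟩)
        (FreeGroup.mk W) =
      FreeGroup.mk (restrictWord T (W.filter fun y => !decide (y.1 ∈ T))
        (fst_not_mem_of_mem_filter T W)) := by
  rw [← lift_kill_mk_eq T _ (fst_not_mem_of_mem_filter T W)]
  have h := lift_comp_killHom (· ∈ T)
    (fun i => if h : i ∈ T then (1 : FreeGroup {i // i ∉ T}) else FreeGroup.of ⟨i, h⟩)
    (fun i hi => by simp [hi])
  conv_lhs => rw [← h]
  rw [MonoidHom.comp_apply, killHom_mk]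
  congr 2
  exact filter_congr fun x _ => by simp

/-! ### Two representatives of a coset -/

omit [DecidableEq ι] in
/-- **Two representatives of one coset of `K` give the same double-coset condition**: if
`x⁻¹ y ∈ K` then `x⁻¹ ∈ K · δ · Z` iff `y⁻¹ ∈ K · δ · Z`. [cite: ZieschangVogtColdewey1980, Thm 4.14.1 p.150] -/
theorem exists_mem_mul_mul_iff_of_inv_mul_mem {G : Type*} [Group G] (K : Subgroup G) (Z : Set G)
    {x y : G} (hxy : x⁻¹ * y ∈ K) (δ : G) :
    (∃ k ∈ K, ∃ z ∈ Z, x⁻¹ = k * δ * z) ↔ (∃ k ∈ K, ∃ z ∈ Z, y⁻¹ = k * δ * z) := by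
  constructor
  · rintro ⟨k, hk, z, hz, he⟩
    refine ⟨(x⁻¹ * y)⁻¹ * k, K.mul_mem (K.inv_mem hxy) hk, z, hz, ?_⟩
    rw [mul_assoc, mul_assoc, ← mul_assoc k, ← he]; group
  · rintro ⟨k, hk, z, hz, he⟩
    refine ⟨(x⁻¹ * y) * k, K.mul_mem hxy hk, z, hz, ?_⟩
    rw [mul_assoc, mul_assoc, ← mul_assoc k, ← he]; group

end Literature.GroupTheory.CombinatorialGroupTheory
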